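/-
Copyright: cell pub-balaban-gaps, seat ne8 (estimate NE7c), gen 11. Project licence.
-/
import Summits.QuantumFields.BalabanUV.T4Continuum.Spine.NE7b.LogConcaveDominatedMoment
import Summits.QuantumFields.BalabanUV.T4Continuum.Spine.NE7c.LiveFactorRestrictedMoment

/-!
# Road (δ) on the LOG-CONCAVE road of «LCS-j»: the symmetric-convex small-field window is FREE at every live threshold (the class
# is closed under threshold scaling); only the DISPLACEMENT letter of the shifted window carries the C8 row (row NE7c; junction J-8)

Cell `pub-balaban-gaps` (G2), seat ne8, estimate **NE7c** (`T4IndicatorShell.ShellWeightBound`; two-run artefact, NOT PRINTED in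
[Bałaban 1983–89], NOT PROVED).  Twenty-first proof-only file under `Spine/NE7c/`; leaf-01 g79's `LogConcaveDominatedMoment`
(p364941) and this seat's file 19 `LiveFactorRestrictedMoment` (p365085) are consumed BY NAME; nothing of Bałaban's is named; 0 `sorry`.

WHY.  File 19 read the OWNER's `(1 − η)⁻¹` road at live letters: the restriction's large-field mass `η` SEES the lowered thresholds —
census row 42, class C8, LOSS `× λ₀²` below ONE threshold-largeness clause.  Leaf-01 g79's LOG-CONCAVE road
(`LogConcaveDominatedMoment.symmConvexRestrictedMoment_le`: for the symmetric convex window `{xᵀQ_bx ≤ θ_b ∀ b}` the domination lemma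
holds at the SAME constant `(√(1−δ))⁻¹^r` with NO large-field-mass hypothesis — thresholds ARBITRARY) makes the CENTRED part of row 42
DISAPPEAR: a window at lowered thresholds `s_b²θ_b` is again a symmetric convex window.  Only the SHIFTED fibre keeps a threshold-bearing
letter — the displacement fraction `η′` of leaf-01's `LogConcaveShiftedFibre.logConcaveShiftedMoment_le(_of_inducedMean_le)` (staged
`g79/stage3`, GO'd W-ne7bp1-g106-1; «the displaced window keeps the fraction `1 − η′` of its own Gaussian mass») — and that letter is supplied
at live letters by file 19's translated-mass pattern (§2 here); plugging §2 into the shifted theorem is ONE application once it lands.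

WHAT IS PROVED ([folklore]):
* §1 `symmConvexRestrictedMoment_le_live` — leaf-01's theorem at the window `{xᵀQ_bx ≤ s_b²θ_b ∀ b}` for ANY assignment `s` (no sign, no
  size, no clause): the constant `(√(1−δ))⁻¹^r` — row 42's centred part is FREE on this road (class-closure, `indicator_qfBall_evenLogConcave`
  at the scaled thresholds).
* §2 `displacement_of_translatedMass` — the displacement letter from a translated large-field-mass bound: `0 ≤ F ≤ 1` measurable,
  `∫(1 − F(u − m))e^{−uᵀSu} ≤ η₀·∫e^{−uᵀSu}` ⟹ `(1 − η₀)·∫F e^{−uᵀSu} ≤ ∫F(u − m)e^{−uᵀSu}`; `displacement_live` — for a window covered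
  by conditions at LIVE thresholds `s_b²θ_b` (`λ₀ ≤ s_b`) with assignment-free induced-mean energy letters `μ_b`, the displacement letter
  holds with the assignment-free `η₀ = Σ_b e^{−(λ₀²θ_b − (1+ε⁻¹)μ_b)∕(1+ε)}(√(1−δ′))⁻¹^{r_b}` (file 19's `translatedMass_le_live`).
READING: on the log-concave road census row 42 shrinks to its DISPLACEMENT part — `displacement_live`'s assignment-free `η₀` is exactly the
`hdisp` letter of leaf-01's shifted theorem (`(1 − η′)·∫F e^{−uᵀSu} ≤ ∫F(u − m₀)e^{−uᵀSu}`, `m₀ = S⁻¹v`), so the delivered stability exponent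
`b_live = B₀∕(1−δ) + r·(−½log(1−δ)) + log(1∕(1−η₀))` is assignment-free (the C8 row sits in `η₀` alone, LOSS `× λ₀²` below file 19's clause;
`B₀` is the far pattern, FREE).  BY-NAME EFFECT ON THE WALL: none.

NOT HERE (honest): Bałaban's windows and remainders ((R1″) ∕ (R2) proper ∕ (A3)); node O; NE7c.  VERDICT WORD UNCHANGED: WORK-bound behind
node O; INSTANCE 0∕1.  NE7c ∕ NE7b NOT PRINTED ∕ NOT PROVED; spine 0∕9; one finite T⁴ — NOT ℝ⁴, NOT infinite volume, NOT the mass gap, NOT Clay.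
HONEST DEPENDENCY (cell): continuum YM on T⁴ ⇐ BetaPertH ∧ nine spine estimates (0∕9 proved); BetaPertH ⇐ (D1) ∧ (D4) ∧ CAP+tail.
-/

set_option autoImplicit false

namespace Summit.QuantumFields.BalabanUV.T4Continuum.Spine.NE7c.LiveFactorLogConcave

open Matrix Finset MeasureTheory Real
open Summit.QuantumFields.BalabanUV.T4Continuum.NE7b.GaussianDominatedMoment
open Summit.QuantumFields.BalabanUV.T4Continuum.NE7b.GaussianRestrictedMoment
open Summit.QuantumFields.BalabanUV.T4Continuum.NE7b.LogConcaveDominatedMoment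
open Summit.QuantumFields.BalabanUV.T4Continuum.Spine.NE7c.LiveFactorRestrictedMoment

variable {n : Type*} [Fintype n] [DecidableEq n]

/-! ## §1 The centred symmetric-convex window at ANY live thresholds: FREE -/

/-- **THE SYMMETRIC-CONVEX WINDOW AT LIVE THRESHOLDS COSTS NOTHING — FOR EVERY ASSIGNMENT.**  Leaf-01's
`symmConvexRestrictedMoment_le` at the window `{x | xᵀQ_bx ≤ s_b²θ_b ∀ b ∈ B}`: the constant `(√(1−δ))⁻¹^r`, no clause, no condition on
the live factors `s` — census row 42's centred part is FREE on the log-concave road. [folklore] -/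
theorem symmConvexRestrictedMoment_le_live {ι : Type*} (B : Finset ι) (Qb : ι → Matrix n n ℝ) (θ s : ι → ℝ)
    (hQb : ∀ b ∈ B, (Qb b).PosSemidef) {S Q : Matrix n n ℝ} {δ : ℝ} {r : ℕ} (hS : S.PosDef) (hQ : Q.PosSemidef)
    (hdom : (δ • S - Q).PosSemidef) (hδ0 : 0 ≤ δ) (hδ : δ < 1) (hr : Q.rank ≤ r) :
    ∫ x, {x : n → ℝ | ∀ b ∈ B, x ⬝ᵥ (Qb b *ᵥ x) ≤ s b ^ 2 * θ b}.indicator (fun _ => (1 : ℝ)) x *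
        (exp (x ⬝ᵥ (Q *ᵥ x)) * exp (-(x ⬝ᵥ (S *ᵥ x)))) ≤
      (√(1 - δ))⁻¹ ^ r * ∫ x, {x : n → ℝ | ∀ b ∈ B, x ⬝ᵥ (Qb b *ᵥ x) ≤ s b ^ 2 * θ b}.indicator (fun _ => (1 : ℝ)) x *
        exp (-(x ⬝ᵥ (S *ᵥ x))) :=
  symmConvexRestrictedMoment_le B Qb (fun b => s b ^ 2 * θ b) hQb hS hQ hdom hδ0 hδ hr

/-! ## §2 The displacement letter from a translated large-field-mass bound -/

/-- **DISPLACEMENT FROM TRANSLATED MASS.**  For `0 ≤ F ≤ 1` measurable and a translation `m`: a bound on the translated restriction's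
large-field mass, `∫ (1 − F(u − m)) e^{−uᵀSu} ≤ η₀·∫ e^{−uᵀSu}`, gives leaf-01's displacement letter
`(1 − η₀)·∫ F e^{−uᵀSu} ≤ ∫ F(u − m) e^{−uᵀSu}` (since `∫ F e^{−S} ≤ ∫ e^{−S}`). [folklore] -/
theorem displacement_of_translatedMass {S : Matrix n n ℝ} (hS : S.PosDef) {F : (n → ℝ) → ℝ} (hF0 : ∀ x, 0 ≤ F x)
    (hF1 : ∀ x, F x ≤ 1) (hFm : Measurable F) (m : n → ℝ) {η₀ : ℝ}
    (hmass : ∫ u, (1 - F (u - m)) * exp (-(u ⬝ᵥ (S *ᵥ u))) ≤ η₀ * ∫ u, exp (-(u ⬝ᵥ (S *ᵥ u)))) :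
    (1 - η₀) * ∫ x, F x * exp (-(x ⬝ᵥ (S *ᵥ x))) ≤ ∫ u, F (u - m) * exp (-(u ⬝ᵥ (S *ᵥ u))) := by
  set I₀ : ℝ := ∫ u, exp (-(u ⬝ᵥ (S *ᵥ u))) with hI₀
  have hFm' : AEStronglyMeasurable (fun u : n → ℝ => F (u - m)) volume :=
    (hFm.comp (measurable_id.sub measurable_const)).aestronglyMeasurable
  have hintT : Integrable (fun u : n → ℝ => F (u - m) * exp (-(u ⬝ᵥ (S *ᵥ u)))) :=
    integrable_bdd_mul_exp_neg_qf hS (fun u => hF0 _) (fun u => hF1 _) hFm'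
  -- `∫ F(u−m) e^{−S} = I₀ − ∫ (1 − F(u−m)) e^{−S} ≥ (1 − η₀) I₀`
  have hsplit : ∫ u, (1 - F (u - m)) * exp (-(u ⬝ᵥ (S *ᵥ u))) = I₀ - ∫ u, F (u - m) * exp (-(u ⬝ᵥ (S *ᵥ u))) := by
    have e : ∀ u : n → ℝ, (1 - F (u - m)) * exp (-(u ⬝ᵥ (S *ᵥ u))) =
        exp (-(u ⬝ᵥ (S *ᵥ u))) - F (u - m) * exp (-(u ⬝ᵥ (S *ᵥ u))) := fun u => by ring
    simp_rw [e]
    exact integral_sub (integrable_exp_neg_qf hS) hintT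
  have hT : (1 - η₀) * I₀ ≤ ∫ u, F (u - m) * exp (-(u ⬝ᵥ (S *ᵥ u))) := by rw [hsplit] at hmass; linarith
  -- `∫ F e^{−S} ≤ I₀`
  have hFI : ∫ x, F x * exp (-(x ⬝ᵥ (S *ᵥ x))) ≤ I₀ := by
    refine integral_mono_of_nonneg (Filter.Eventually.of_forall fun x => mul_nonneg (hF0 x) (exp_pos _).le)
      (integrable_exp_neg_qf hS) (Filter.Eventually.of_forall fun x => ?_)
    have h := mul_le_mul_of_nonneg_right (hF1 x) (exp_pos (-(x ⬝ᵥ (S *ᵥ x)))).le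
    simpa only [one_mul] using h
  by_cases hη : η₀ ≤ 1
  · have h1 : 0 ≤ 1 - η₀ := by linarith
    exact (mul_le_mul_of_nonneg_left hFI h1).trans hT
  · -- `η₀ > 1`: the left side is non-positive
    have h1 : 1 - η₀ ≤ 0 := by linarith
    have hF : 0 ≤ ∫ x, F x * exp (-(x ⬝ᵥ (S *ᵥ x))) := integral_nonneg fun x => mul_nonneg (hF0 x) (exp_pos _).le
    exact (mul_nonpos_of_nonpos_of_nonneg h1 hF).trans (integral_nonneg fun u => mul_nonneg (hF0 _) (exp_pos _).le)

/-- **THE DISPLACEMENT LETTER AT LIVE LETTERS.**  A window `0 ≤ F ≤ 1` covered by large-field conditions at LIVE thresholds `s_b²θ_b`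
(`λ₀ ≤ s_b`, `θ_b ≥ 0`), each `Q_b` positive semidefinite, `δ′`-dominated, of rank `≤ r_b`, and assignment-free induced-mean energy letters
`mᵀQ_bm ≤ μ_b`: the displacement letter holds with the ASSIGNMENT-FREE fraction
`η₀ = Σ_b e^{−(λ₀²θ_b − (1+ε⁻¹)μ_b)∕(1+ε)}·(√(1−δ′))⁻¹^{r_b}` — file 19's `translatedMass_le_live` + `displacement_of_translatedMass`. [folklore] -/
theorem displacement_live {ι : Type*} (B : Finset ι) {S : Matrix n n ℝ} (Qb : ι → Matrix n n ℝ) (θ μb : ι → ℝ)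
    (rb : ι → ℕ) {δ' : ℝ} (hS : S.PosDef) (hQ : ∀ b ∈ B, (Qb b).PosSemidef)
    (hdom : ∀ b ∈ B, (δ' • S - Qb b).PosSemidef) (hδ0 : 0 ≤ δ') (hδ : δ' < 1) (hr : ∀ b ∈ B, (Qb b).rank ≤ rb b)
    {F : (n → ℝ) → ℝ} (hF0 : ∀ x, 0 ≤ F x) (hF1 : ∀ x, F x ≤ 1) (hFm : Measurable F) (s : ι → ℝ) {lam₀ : ℝ} (h0 : 0 ≤ lam₀)
    (hs : ∀ b ∈ B, lam₀ ≤ s b) (hθ : ∀ b ∈ B, 0 ≤ θ b)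
    (hcov : ∀ x, 1 - F x ≤ ∑ b ∈ B, Set.indicator {x | s b ^ 2 * θ b ≤ x ⬝ᵥ (Qb b *ᵥ x)} (fun _ => (1 : ℝ)) x)
    (m : n → ℝ) (hm : ∀ b ∈ B, m ⬝ᵥ (Qb b *ᵥ m) ≤ μb b) {ε : ℝ} (hε : 0 < ε) :
    (1 - (∑ b ∈ B, exp (-((lam₀ ^ 2 * θ b - (1 + ε⁻¹) * μb b) / (1 + ε))) * (√(1 - δ'))⁻¹ ^ rb b)) *
        ∫ x, F x * exp (-(x ⬝ᵥ (S *ᵥ x))) ≤ ∫ u, F (u - m) * exp (-(u ⬝ᵥ (S *ᵥ u))) :=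
  displacement_of_translatedMass hS hF0 hF1 hFm m
    (translatedMass_le_live B Qb θ μb rb hS hQ hdom hδ0 hδ hr hF1 s h0 hs hθ hcov m hm hε)

end Summit.QuantumFields.BalabanUV.T4Continuum.Spine.NE7c.LiveFactorLogConcave
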